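import Mathlib.Analysis.Calculus.Deriv.ZPow
import Mathlib.Analysis.Calculus.Deriv.Mul
import Mathlib.Analysis.Calculus.Deriv.Polynomial
import Mathlib.RingTheory.Algebraic.Integral
import Literature.NumberTheory.Transcendental.KZCalculus
import Literature.NumberTheory.Transcendental.KZSemialgebraicComplex
import Literature.NumberTheory.Transcendental.SemialgebraicLineDeriv
import Literature.NumberTheory.Transcendental.KZIntervalPeriodProofs
import Literature.NumberTheory.Transcendental.KZCubicalCalculus
import Summits.KontsevichZagierPeriods.KontsevichZagierPeriods.Theorems.LiouvilleUnfoldingLogPrimitiveNLStubCellwiseFoldAux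

/-!
# `StokesGeneration` (stmt-KontsevichZagierPeriods-3586) — line `fibrewise_stokes`, stub `stub_rungDlogProd`

Registered stub R5 (dlog-sector rung) of the line `fibrewise_stokes` of the crux `StokesGeneration`
(route UnfoldedStokes): **the normalised product attached to an integer multiplicative relation
between values of positive algebraic polynomials.** For real polynomials `pᵢ` with algebraic
coefficients, positive on `[0,1]`, and `M ∈ ℤ^s` with `Πᵢ (pᵢ(1)/pᵢ(0))^{Mᵢ} = 1`, the rational
function `P(u) = Πᵢ (pᵢ(u)/pᵢ(0))^{Mᵢ}` satisfies: `P > 0` on `[0,1]` (every factor base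
`pᵢ(u)/pᵢ(0)` is positive there), `P(0) = 1` (a product of `1`'s), `P(1) = 1` (the relation),
`P' = P · Σᵢ Mᵢ pᵢ'(u)/pᵢ(u)` is the derivative of `P` at every point of `[0,1]` (product rule
`HasDerivAt.fun_finsetProd` and `d/du (p(u)/c)^M = (p(u)/c)^M · M p'(u)/p(u)`), `P, P'` are
continuous on `[0,1]`, `P'/P = Σᵢ Mᵢ pᵢ'/pᵢ` on `[0,1]`, and `x ↦ P (x 0)`, `x ↦ P' (x 0)` are
`ℚ`-semialgebraic functions on the closed square `[0,1]²` (finite products / sums / integer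
powers / quotients of polynomials in a coordinate with real-algebraic coefficients,
Bochnak–Coste–Roy Prop. 2.2.6; the integer-power rule is the landed `LogPrimitiveNL.fold_fun_zpow`,
real-algebraic constants are `ℚ`-semialgebraic by Kontsevich–Zagier §1.1).

References: J. Bochnak, M. Coste, M.-F. Roy, *Real Algebraic Geometry* (1998), Prop. 2.2.6;
M. Kontsevich, D. Zagier, *Periods* (2001), §1.1.
-/

noncomputable section

-- `Summit.KontsevichZagierPeriods.KontsevichZagierPeriods.…` is the tree's mandated layout (single-conjunct summit).
set_option linter.dupNamespace false

namespace Summit.KontsevichZagierPeriods.KontsevichZagierPeriods.Cruxes.StokesGeneration.FibrewiseStokes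

open MeasureTheory Set
open Literature.NumberTheory.Transcendental
open Literature.NumberTheory.Transcendental.KZ
open Literature.ModelTheory.ExponentialFields (IsSemialgebraic)
open Summit.KontsevichZagierPeriods.LiouvilleUnfolding.LogPrimitiveNL
  (fold_fun_zpow fold_isSemialgebraicFunOn_one)

/-! ## The factors `p(u)/p(0)` -/

/-- The derivative of one factor: `d/du (q(u)/c)^M = (q(u)/c)^M · (M · q'(u)/q(u))` wherever
`q(u) ≠ 0` (`c ≠ 0`). [folklore] -/
theorem hasDerivAt_rung_polyFactor (q : Polynomial ℝ) {c : ℝ} (hc : c ≠ 0) (M : ℤ) {u : ℝ}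
    (hq : q.eval u ≠ 0) :
    HasDerivAt (fun v => (q.eval v / c) ^ M)
      ((q.eval u / c) ^ M * ((M : ℝ) * ((Polynomial.derivative q).eval u / q.eval u))) u := by
  have hqc : q.eval u / c ≠ 0 := div_ne_zero hq hc
  have hg : HasDerivAt (fun v => q.eval v / c) ((Polynomial.derivative q).eval u / c) u :=
    (q.hasDerivAt u).div_const c
  have hz : HasDerivAt (fun v => (q.eval v / c) ^ M)
      ((M : ℝ) * (q.eval u / c) ^ (M - 1) * ((Polynomial.derivative q).eval u / c)) u := by
    have := (hasDerivAt_zpow M (q.eval u / c) (Or.inl hqc)).comp u hg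
    exact this
  refine hz.congr_deriv ?_
  rw [zpow_sub_one₀ hqc]
  generalize (q.eval u / c) ^ M = w
  field_simp

/-- The coefficients of the derivative of a real polynomial with algebraic coefficients are
algebraic (`(p')ₙ = (n + 1) pₙ₊₁`). [folklore] -/
theorem isAlgebraic_coeff_derivative {q : Polynomial ℝ} (hq : ∀ n, IsAlgebraic ℚ (q.coeff n))
    (n : ℕ) : IsAlgebraic ℚ ((Polynomial.derivative q).coeff n) := by
  rw [Polynomial.coeff_derivative]
  exact (hq (n + 1)).mul ((isAlgebraic_nat n).add isAlgebraic_one)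

/-- A real polynomial with algebraic coefficients, read on one coordinate `z ↦ q (z j)`, is a
`ℚ`-semialgebraic function on every `ℚ`-semialgebraic subset of `ℝᵐ`: it is the finite sum
`Σₙ qₙ (z j)ⁿ` of products of real-algebraic constants (Kontsevich–Zagier 2001, §1.1) and powers of
a coordinate function (Bochnak–Coste–Roy Prop. 2.2.6). [folklore] -/
theorem isSemialgebraicFunOn_eval_apply {m : ℕ} {W : Set (Fin m → ℝ)} (hW : IsSemialgebraic ℚ W)
    {q : Polynomial ℝ} (hq : ∀ n, IsAlgebraic ℚ (q.coeff n)) (j : Fin m) :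
    IsSemialgebraicFunOn ℚ W (fun z => q.eval (z j)) := by
  have h : IsSemialgebraicFunOn ℚ W (fun z => ∑ n ∈ q.support, q.coeff n * (z j) ^ n) :=
    IsSemialgebraicFunOn.fun_finsetSum _ hW fun n _ =>
      (isSemialgebraicFunOn_const_of_isAlgebraic hW (hq n)).fun_mul
        ((isSemialgebraicFunOn_apply hW j).fun_pow n)
  refine h.congr fun z _ => ?_
  rw [Polynomial.eval_eq_sum, Polynomial.sum_def]

/-! ## The stub -/

/-- STUB (rung, R5) **the normalised product attached to a multiplicative relation between values
of positive algebraic polynomials**: for real polynomials `pᵢ` with algebraic coefficients,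
positive on `[0,1]`, and `M ∈ ℤ^s` with `Πᵢ (pᵢ(1)/pᵢ(0))^{Mᵢ} = 1`, the rational function
`P(u) = Πᵢ (pᵢ(u)/pᵢ(0))^{Mᵢ}` is positive on `[0,1]`, `P(0) = P(1) = 1`, differentiable with
`P' = P · Σᵢ Mᵢ pᵢ'/pᵢ`, `P, P'` continuous on `[0,1]` and `ℚ`-semialgebraic on the square (as
functions of `x 0`), and `P'/P = Σᵢ Mᵢ pᵢ'/pᵢ` on `[0,1]`. [folklore] -/
theorem stub_rungDlogProd :
    ∀ (s : ℕ) (p : Fin s → Polynomial ℝ) (M : Fin s → ℤ) (P P' : ℝ → ℝ),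
      (∀ i n, IsAlgebraic ℚ ((p i).coeff n)) → (∀ i, ∀ u ∈ Set.Icc (0:ℝ) 1, 0 < (p i).eval u) →
      ∏ i, ((p i).eval 1 / (p i).eval 0) ^ (M i) = 1 →
      (∀ u, P u = ∏ i, ((p i).eval u / (p i).eval 0) ^ (M i)) →
      (∀ u, P' u = P u * ∑ i, (M i : ℝ) * ((Polynomial.derivative (p i)).eval u / (p i).eval u)) →
      IsSemialgebraicFunOn ℚ (Set.pi Set.univ (fun _ : Fin 2 => Set.Icc (0:ℝ) 1)) (fun x => P (x 0)) ∧
        IsSemialgebraicFunOn ℚ (Set.pi Set.univ (fun _ : Fin 2 => Set.Icc (0:ℝ) 1)) (fun x => P' (x 0)) ∧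
        (∀ u ∈ Set.Icc (0:ℝ) 1, 0 < P u) ∧ P 0 = 1 ∧ P 1 = 1 ∧
        ContinuousOn P (Set.Icc (0:ℝ) 1) ∧ ContinuousOn P' (Set.Icc (0:ℝ) 1) ∧
        (∀ u ∈ Set.Ioo (0:ℝ) 1, HasDerivAt P (P' u) u) ∧
        ∀ u ∈ Set.Icc (0:ℝ) 1, P' u / P u = ∑ i, (M i : ℝ) * ((Polynomial.derivative (p i)).eval u / (p i).eval u) := by
  intro s p M P P' halg hpos hrel hP hP'
  have h0mem : (0:ℝ) ∈ Set.Icc (0:ℝ) 1 := ⟨le_rfl, zero_le_one⟩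
  have hp0 : ∀ i, 0 < (p i).eval 0 := fun i => hpos i 0 h0mem
  -- positivity of the factor bases and of `P` on `[0,1]`
  have hbase : ∀ i, ∀ u ∈ Set.Icc (0:ℝ) 1, 0 < (p i).eval u / (p i).eval 0 := fun i u hu =>
    div_pos (hpos i u hu) (hp0 i)
  have hPpos : ∀ u ∈ Set.Icc (0:ℝ) 1, 0 < P u := fun u hu => by
    rw [hP u]
    exact Finset.prod_pos fun i _ => zpow_pos (hbase i u hu) _
  -- the derivative of `P` at every point of `[0,1]`
  have hPfun : P = fun v => ∏ i, ((p i).eval v / (p i).eval 0) ^ (M i) := funext hP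
  have hderiv : ∀ u ∈ Set.Icc (0:ℝ) 1, HasDerivAt P (P' u) u := by
    intro u hu
    have hfac : ∀ i ∈ (Finset.univ : Finset (Fin s)),
        HasDerivAt (fun v => ((p i).eval v / (p i).eval 0) ^ (M i))
          (((p i).eval u / (p i).eval 0) ^ (M i) *
            ((M i : ℝ) * ((Polynomial.derivative (p i)).eval u / (p i).eval u))) u := fun i _ =>
      hasDerivAt_rung_polyFactor (p i) (hp0 i).ne' (M i) (hpos i u hu).ne'
    have key : HasDerivAt (fun v => ∏ i, ((p i).eval v / (p i).eval 0) ^ (M i))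
        ((∏ i, ((p i).eval u / (p i).eval 0) ^ (M i)) *
          ∑ i, (M i : ℝ) * ((Polynomial.derivative (p i)).eval u / (p i).eval u)) u := by
      refine (HasDerivAt.fun_finsetProd hfac).congr_deriv ?_
      rw [Finset.mul_sum]
      refine Finset.sum_congr rfl fun i _ => ?_
      rw [smul_eq_mul, ← mul_assoc, Finset.prod_erase_mul _ _ (Finset.mem_univ i)]
    rw [hP' u, hP u, hPfun]
    exact key
  -- continuity
  have hPcont : ContinuousOn P (Set.Icc (0:ℝ) 1) := fun u hu =>
    (hderiv u hu).continuousAt.continuousWithinAt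
  have hP'cont : ContinuousOn P' (Set.Icc (0:ℝ) 1) := by
    have hP'fun : P' = fun u =>
        P u * ∑ i, (M i : ℝ) * ((Polynomial.derivative (p i)).eval u / (p i).eval u) := funext hP'
    rw [hP'fun]
    exact hPcont.mul (continuousOn_finsetSum _ fun i _ =>
      continuousOn_const.mul ((Polynomial.continuousOn _).div (Polynomial.continuousOn _)
        fun u hu => (hpos i u hu).ne'))
  -- semialgebraicity on the square
  have hS : IsSemialgebraic ℚ (Set.pi Set.univ (fun _ : Fin 2 => Set.Icc (0:ℝ) 1)) := by
    rw [← cube_eq_pi]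
    exact isSemialgebraic_cube
  have hx0 : ∀ x ∈ Set.pi Set.univ (fun _ : Fin 2 => Set.Icc (0:ℝ) 1), x 0 ∈ Set.Icc (0:ℝ) 1 :=
    fun x hx => hx 0 (Set.mem_univ _)
  have halg0 : ∀ i, IsAlgebraic ℚ ((p i).eval 0) := fun i => by
    rw [← Polynomial.coeff_zero_eq_eval_zero]
    exact halg i 0
  have hpS : ∀ i, IsSemialgebraicFunOn ℚ (Set.pi Set.univ (fun _ : Fin 2 => Set.Icc (0:ℝ) 1))
      (fun x => (p i).eval (x 0)) := fun i =>
    isSemialgebraicFunOn_eval_apply hS (halg i) 0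
  have hp'S : ∀ i, IsSemialgebraicFunOn ℚ (Set.pi Set.univ (fun _ : Fin 2 => Set.Icc (0:ℝ) 1))
      (fun x => (Polynomial.derivative (p i)).eval (x 0)) := fun i =>
    isSemialgebraicFunOn_eval_apply hS (isAlgebraic_coeff_derivative (halg i)) 0
  have hPS : IsSemialgebraicFunOn ℚ (Set.pi Set.univ (fun _ : Fin 2 => Set.Icc (0:ℝ) 1))
      (fun x => ∏ i, ((p i).eval (x 0) / (p i).eval 0) ^ (M i)) :=
    IsSemialgebraicFunOn.fun_finsetProd Finset.univ hS fun i _ =>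
      fold_fun_zpow ((hpS i).div (isSemialgebraicFunOn_const_of_isAlgebraic hS (halg0 i))
        fun _ _ => (hp0 i).ne') (M i)
  have hsumS : IsSemialgebraicFunOn ℚ (Set.pi Set.univ (fun _ : Fin 2 => Set.Icc (0:ℝ) 1))
      (fun x => ∑ i, (M i : ℝ) * ((Polynomial.derivative (p i)).eval (x 0) / (p i).eval (x 0))) :=
    IsSemialgebraicFunOn.fun_finsetSum Finset.univ hS fun i _ =>
      (isSemialgebraicFunOn_const_intCast hS (M i)).fun_mul
        (((hp'S i).div (hpS i)) fun x hx => (hpos i _ (hx0 x hx)).ne')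
  refine ⟨hPS.congr fun x _ => (hP (x 0)).symm,
    (hPS.fun_mul hsumS).congr fun x _ => by rw [hP' (x 0), hP (x 0)],
    hPpos, ?_, ?_, hPcont, hP'cont, fun u hu => hderiv u (Set.Ioo_subset_Icc_self hu),
    fun u hu => by rw [hP' u, mul_div_cancel_left₀ _ (hPpos u hu).ne']⟩
  · rw [hP 0]
    exact Finset.prod_eq_one fun i _ => by rw [div_self (hp0 i).ne', one_zpow]
  · rw [hP 1]
    exact hrel

end Summit.KontsevichZagierPeriods.KontsevichZagierPeriods.Cruxes.StokesGeneration.FibrewiseStokes
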